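import Summits.Ventures.HodgeRepro2.Hypothesis

/-!
# HodgeRepro2 — sign elements by weak approximation (proved)

Blind re-derivation cell `pub-hodge-repro2`, seat p2 (file 3; files 1–2 = `Hypothesis.lean`,
`Incoherent.lean`; this file imports only `Hypothesis.lean`).  Everything here is PROVED (no statement shapes).

## Contents
* `exists_re_sign_prescribed`: weak approximation at the infinite places of a number field `F`
  (Mathlib `NumberField.InfinitePlace.denseRange_algebraMap_pi`) gives `x ∈ F` with prescribed
  signs of `Re(v(x))` at all infinite places; `exists_pos_at_neg_elsewhere`: the transfer's `δ`
  (positive at one real place, negative at the others), TIER3.md §2 / §7 (ii).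
* `exists_imaginary_ne_zero`, `im_embedding_algebraMap_eq_zero`,
  `embedding_algebraMap_eq_of_mk_eq`: elementary facts on a CM-field `K`.
* `exists_imaginary_of_cmTypeChoice`: for every CM-type choice `Φ` of `K` there is a non-zero
  purely imaginary `e` with `Im τ'(e) < 0` for all `τ' ∈ Φ` — the sign datum `e ∈ E^{×-}` of
  [Liu21] Definition 4.12 (`ε` is `μ`-admissible iff such an `e` exists for `Φ = Φ_μ`), and the
  "totally positive imaginary" `ζ` turning a hermitian `H` into Shimura's skew-hermitian
  `T = ζH` with `-iT^{τ_ν}` of prescribed signature ([Sh79] (4.2)).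

## Sources (locators as printed)
[Sh79] G. Shimura, J. Math. Soc. Japan 31 (1979) 561–592, §4 (4.2).  [Liu21] Y. Liu, Cambridge
J. Math. 9 (2021) 1–147, Definition 4.12 p. 47.  Shimura, *Arithmetic of Hermitian forms*,
Doc. Math. 13 (2008) 739–774, proof of Theorem 2.2 p. 748 (the sign element `c ∈ F^×`).
-/

namespace Summit.Ventures.HodgeRepro2.ShimuraData

open NumberField

section WeakApproximation

variable (F : Type*) [Field F] [NumberField F]

/-- **Weak approximation at the infinite places, sign form**: for every assignment of signs to the
infinite places of a number field `F` there is `x ∈ F` whose complex embeddings have real parts of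
the prescribed signs (all non-zero).  From Mathlib's
`NumberField.InfinitePlace.denseRange_algebraMap_pi`.  For a totally real `F` this is the
"signature bookkeeping" element `δ` of the transfer (`ι₁ δ > 0`, `ι_ν δ < 0` for `ν ≠ 1`), cf.
[Sh79] (4.2) (`-iT^{τ_ν}` with prescribed signatures) and Shimura, Doc. Math. 13 (2008),
proof of Theorem 2.2 ("take `c ∈ F^×` so that `c < 0` or `c > 0` at `v ∈ r0` according as …"). -/
theorem exists_re_sign_prescribed (σ : InfinitePlace F → Bool) :
    ∃ x : F, ∀ v : InfinitePlace F,
      (0 < (v.embedding x).re ↔ σ v = true) ∧ (v.embedding x).re ≠ 0 := by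
  classical
  let t : InfinitePlace F → F := fun v => if σ v then 1 else -1
  let p : (v : InfinitePlace F) → WithAbs v.1 := fun v => WithAbs.toAbs v.1 (t v)
  obtain ⟨x, hx⟩ :=
    Metric.denseRange_iff.mp (InfinitePlace.denseRange_algebraMap_pi F) p 1 one_pos
  refine ⟨x, fun v => ?_⟩
  have hv : dist (p v) (algebraMap F ((w : InfinitePlace F) → WithAbs w.1) x v) < 1 :=
    lt_of_le_of_lt (dist_le_pi_dist p _ v) hx
  have hv' : ‖v.embedding (t v) - v.embedding x‖ < 1 := by
    rw [← map_sub, InfinitePlace.norm_embedding_eq]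
    have hx' : ((algebraMap F (WithAbs v.1)) x).ofAbs = x := rfl
    simpa [dist_eq_norm, WithAbs.norm_eq_apply_ofAbs, p, hx', InfinitePlace.coe_apply] using hv
  have hre : |(v.embedding (t v) - v.embedding x).re| < 1 :=
    lt_of_le_of_lt (Complex.abs_re_le_norm _) hv'
  rw [Complex.sub_re] at hre
  by_cases hσ : σ v = true
  · have ht : t v = 1 := by simp [t, hσ]
    rw [ht, map_one, Complex.one_re] at hre
    rw [abs_lt] at hre
    refine ⟨⟨fun _ => hσ, fun _ => by linarith [hre.1, hre.2]⟩, ?_⟩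
    intro h0; rw [h0] at hre; linarith [hre.2]
  · have ht : t v = -1 := by simp [t, hσ]
    rw [ht, map_neg, map_one, Complex.neg_re, Complex.one_re] at hre
    rw [abs_lt] at hre
    refine ⟨⟨fun h => absurd (by linarith [hre.1, hre.2] : (v.embedding x).re < 0)
      (not_lt.mpr h.le), fun h => absurd h hσ⟩, ?_⟩
    intro h0; rw [h0] at hre; linarith [hre.1]

/-- The element `δ` of the transfer: positive at one chosen infinite place `v₁` and negative at
all the others ([Sh79] §8 / TIER3 §2: `h = x₁ȳ₁ + x₂ȳ₂ − δ x₃ȳ₃` with `ι₁ δ > 0`, `ι_ν δ < 0`). -/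
theorem exists_pos_at_neg_elsewhere (v₁ : InfinitePlace F) :
    ∃ δ : F, 0 < (v₁.embedding δ).re ∧
      ∀ v : InfinitePlace F, v ≠ v₁ → (v.embedding δ).re < 0 := by
  classical
  obtain ⟨δ, hδ⟩ := exists_re_sign_prescribed F (fun v => decide (v = v₁))
  refine ⟨δ, (hδ v₁).1.mpr (by simp), fun v hv => ?_⟩
  have h1 := (hδ v).1
  have h2 := (hδ v).2
  have : ¬ (0 < (v.embedding δ).re) := fun h => by simpa [hv] using h1.mp h
  exact lt_of_le_of_ne (not_lt.mp this) h2

end WeakApproximation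

section ImaginaryOfCMType

variable (K : Type*) [Field K] [NumberField K] [IsCMField K]

/-- A CM-field has a non-zero purely imaginary element (`ρ η = -η`): take `x - ρ x` for any `x`
not fixed by `ρ` (`ρ ≠ 1`, Mathlib `IsCMField.complexConj_ne_one`). -/
theorem exists_imaginary_ne_zero : ∃ η : K, ρ K η = -η ∧ η ≠ 0 := by
  obtain ⟨x, hx⟩ : ∃ x : K, ρ K x ≠ x := by
    by_contra h
    exact IsCMField.complexConj_ne_one K (AlgEquiv.ext fun x => by_contra fun hx => h ⟨x, hx⟩)
  refine ⟨x - ρ K x, ?_, sub_ne_zero.mpr (Ne.symm hx)⟩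
  rw [map_sub, IsCMField.complexConj_apply_apply]
  ring

/-- A complex embedding of a CM-field takes real values on the maximal real subfield
(`conj (τ x) = τ (ρ x) = τ x` for `x ∈ K⁺`). -/
theorem im_embedding_algebraMap_eq_zero (τ : K →+* ℂ) (x : maximalRealSubfield K) :
    (τ (algebraMap (maximalRealSubfield K) K x)).im = 0 := by
  have hcoe : algebraMap (maximalRealSubfield K) K x = (x : K) := rfl
  rw [← Complex.conj_eq_iff_im, ← IsCMField.complexEmbedding_complexConj, hcoe,
    IsCMField.complexConj_apply_eq_self]

/-- Two embeddings above the same infinite place agree on the maximal real subfield. -/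
theorem embedding_algebraMap_eq_of_mk_eq {τ τ' : K →+* ℂ} (h : InfinitePlace.mk τ = InfinitePlace.mk τ')
    (x : maximalRealSubfield K) :
    τ (algebraMap (maximalRealSubfield K) K x) = τ' (algebraMap (maximalRealSubfield K) K x) := by
  rcases InfinitePlace.mk_eq_iff.mp h with h | h
  · rw [h]
  · rw [← h, ComplexEmbedding.conjugate_coe_eq,
      Complex.conj_eq_iff_im.mpr (im_embedding_algebraMap_eq_zero K τ x)]

/-- **Existence of the sign element for a CM-type** (TIER3 §7 (ii), in the form of [Liu21]
Definition 4.12): for every CM-type choice `Φ` of `K` there is a non-zero purely imaginary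
`e ∈ K` (`ρ e = -e`) with `Im τ'(e) < 0` for every embedding `τ'` chosen by `Φ`, i.e.
`range Φ ⊆ cmTypeOfImaginary e` in the notation of `Incoherent.lean` (and then equality, by
`cmTypeOfImaginary_isCMType` there).
Proof: `e = δ η` with `η` purely imaginary and `δ` in the maximal real subfield with the signs
prescribed by weak approximation. -/
theorem exists_imaginary_of_cmTypeChoice (Φ : CMTypeChoice K) :
    ∃ e : K, ρ K e = -e ∧ e ≠ 0 ∧ ∀ w : InfinitePlace K, (Φ.emb w e).im < 0 := by
  classical
  obtain ⟨η, hη, hη0⟩ := exists_imaginary_ne_zero K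
  let σ : InfinitePlace (maximalRealSubfield K) → Bool := fun v =>
    decide ((Φ.emb ((IsCMField.equivInfinitePlace K).symm v) η).im < 0)
  obtain ⟨δ, hδ⟩ := exists_re_sign_prescribed (maximalRealSubfield K) σ
  have key : ∀ w : InfinitePlace K, (Φ.emb w (algebraMap _ K δ * η)).im < 0 := by
    intro w
    -- the real place below `w` and the value of `δ` there
    set v : InfinitePlace (maximalRealSubfield K) := IsCMField.equivInfinitePlace K w with hv
    have hw : (IsCMField.equivInfinitePlace K).symm v = w := by rw [hv, Equiv.symm_apply_apply]
    have hδv : Φ.emb w (algebraMap (maximalRealSubfield K) K δ) = ((v.embedding δ).re : ℂ) := by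
      -- `v.embedding = w.embedding ∘ algebraMap`, and `Φ.emb w` agrees with `w.embedding` on `K⁺`
      have h0 : v = InfinitePlace.mk (w.embedding.comp (algebraMap (maximalRealSubfield K) K)) := by
        rw [hv, IsCMField.equivInfinitePlace_apply, ← InfinitePlace.comap_mk,
          InfinitePlace.mk_embedding]
      have h1 : v.embedding = w.embedding.comp (algebraMap (maximalRealSubfield K) K) := by
        rw [h0]
        exact InfinitePlace.embedding_mk_eq_of_isReal (IsTotallyReal.complexEmbedding_isReal _)
      have h2 : Φ.emb w (algebraMap (maximalRealSubfield K) K δ) =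
          w.embedding (algebraMap (maximalRealSubfield K) K δ) :=
        embedding_algebraMap_eq_of_mk_eq K (by rw [Φ.emb_mk, InfinitePlace.mk_embedding]) δ
      rw [h2, h1, RingHom.comp_apply]
      exact (Complex.conj_eq_iff_re.mp
        (Complex.conj_eq_iff_im.mpr (im_embedding_algebraMap_eq_zero K w.embedding δ))).symm
    have hσ := hδ v
    simp only [map_mul, hδv, Complex.mul_im, Complex.ofReal_re, Complex.ofReal_im, zero_mul,
      add_zero]
    have hηim : (Φ.emb w η).im ≠ 0 := by
      intro h0
      have hc : ((starRingEnd ℂ).comp (Φ.emb w)) η = -(Φ.emb w η) := by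
        rw [RingHom.comp_apply, ← IsCMField.complexEmbedding_complexConj K (Φ.emb w) η, hη, map_neg]
      have hre : (Φ.emb w η).re = 0 := by
        have h := congrArg Complex.re hc
        rw [RingHom.comp_apply, Complex.conj_re, Complex.neg_re] at h
        linarith
      exact hη0 ((map_eq_zero (Φ.emb w)).mp (Complex.ext hre h0))
    rcases lt_or_gt_of_ne hηim with hneg | hpos
    · have : σ v = true := by simp [σ, hw, hneg]
      have hr : 0 < (v.embedding δ).re := hσ.1.mpr this
      exact mul_neg_of_pos_of_neg hr hneg
    · have : σ v = false := by simp [σ, hw, not_lt.mpr hpos.le]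
      have hr : (v.embedding δ).re < 0 :=
        lt_of_le_of_ne (not_lt.mp fun h => by simpa [this] using hσ.1.mp h) hσ.2
      exact mul_neg_of_neg_of_pos hr hpos
  refine ⟨algebraMap _ K δ * η, ?_, ?_, key⟩
  · have hcoe : algebraMap (maximalRealSubfield K) K δ = (δ : K) := rfl
    rw [map_mul, hη, hcoe, IsCMField.complexConj_apply_eq_self, mul_neg]
  · intro h0
    obtain ⟨w⟩ := (inferInstance : Nonempty (InfinitePlace K))
    have := key w
    simp [h0] at this

end ImaginaryOfCMType

end Summit.Ventures.HodgeRepro2.ShimuraData
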